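import Mathlib
import Summits.Ventures.PercRepro2.TypedResidualCrux
import Summits.Ventures.PercRepro2.TypedResidualMarks
import Summits.Ventures.PercRepro2.RootBridgeVanish
import Summits.Ventures.PercRepro2.A3InactiveTypedNR

/-!
# The narrowed domain of sub-claim S4 (blind cell PercRepro2, p2 g0, 2026-08-25; sub-claim S1,
`proofs/subclaims/S1-REDUCTION.md`; the lead's rulings INBOX 2026-08-25T01:19:23Z / 01:23:06Z /
02:14:43Z)

`TypedResidualCrux.lean` gives the crux of record from `ResidualCon_all R` — row 2′TRI on the
root-connected residual instances. Two classes of such instances are theorems of the cell: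

* the ROOT-BRIDGE SAME-SIDE class (sub-claim S2.b, p3, `RootBridgeVanish.lean`): a typed edge
  `f = {a₁, v}` whose removal separates the roots, `v` on `a₂`'s side, `o, b` on `a₁`'s side
  (`RootBridge.HasRootBridgeSameSide'`, every placement of `a₃`) — UNCONDITIONAL;
* the `a₃`-INACTIVE class (sub-claim S4, p5, `A3InactiveTypedNR.lean`): `a₃` of typed degree `0`
  — CONDITIONAL on p5's named hypothesis `A3InactiveTyped.TB14 R` (the typed BHK 1.4 for
  single-vertex events: a conjecture of the cell, two seats two codes at `n = 6`; never a fact).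

Hence:

* **`ResidualCon2`** — `ResidualCon` without a same-side root bridge at `a₁`;
  **`HCov_all_of_residualCon2_all : ResidualCon2_all R → HCov_all R`** (unconditional);
* **`ResidualCon3`** — `ResidualCon2` with `a₃` of typed degree `≥ 1`;
  **`HCov_all_of_residualCon3_all (hTB : A3InactiveTyped.TB14 R) : ResidualCon3_all R → HCov_all R`**
  — CONDITIONAL on `TB14`, kept separate from the unconditional assembly (the root
  coincidences `a₃ ∈ {a₁, a₂}` are handled by `TypedResidualMarks.lean`).

Own code; standard axioms (the conditional theorem takes `TB14` as an explicit hypothesis).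
-/

namespace Summit.Ventures.PercRepro2

open UnionCluster

namespace CovForm

namespace TypedRed

section Con2

variable {V : Type*} {E : Type*} [DecidableEq V] [Fintype E] [DecidableEq E]

/-- **`NR`, root-connected, without a same-side root bridge at `a₁`** (sub-claim S2.b subtracted):
the narrowed unconditional domain of sub-claim S4. -/
structure ResidualCon2 (ends : E → Sym2 V) (o a₁ a₂ a₃ b : V) (F : Finset E) : Prop where
  residualCon : ResidualCon ends o a₁ a₂ a₃ b F
  no_bridge : ¬ RootBridge.HasRootBridgeSameSide' ends o a₁ a₂ b F

/-- **`ResidualCon2` with `a₃` of typed degree at least one** (the `a₃`-inactive class subtracted,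
conditionally on `TB14`). -/
structure ResidualCon3 (ends : E → Sym2 V) (o a₁ a₂ a₃ b : V) (F : Finset E) : Prop where
  residualCon2 : ResidualCon2 ends o a₁ a₂ a₃ b F
  a3_active : ∃ e ∈ F, a₃ ∈ ends e

end Con2

section Closure

variable (R : Type*) [Field R] [LinearOrder R] [IsStrictOrderedRing R]

/-- **Row 2′TRI on `ResidualCon2`, over every finite graph.** -/
def ResidualCon2_all : Prop :=
  ∀ (V E : Type) [Fintype V] [DecidableEq V] [Fintype E] [DecidableEq E]
    (ends : E → Sym2 V) (o a₁ a₂ a₃ b : V) (F : Finset E) (τ : E → ℕ),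
    (∀ e ∈ F, τ e = 1 ∨ τ e = 2) → ResidualCon2 ends o a₁ a₂ a₃ b F →
      0 ≤ typedCount F (fun _ => false) τ
        (K3 ends o a₁ a₂ a₃ b : Config E → Config E → Config E → R)

/-- **Row 2′TRI on `ResidualCon3`, over every finite graph.** -/
def ResidualCon3_all : Prop :=
  ∀ (V E : Type) [Fintype V] [DecidableEq V] [Fintype E] [DecidableEq E]
    (ends : E → Sym2 V) (o a₁ a₂ a₃ b : V) (F : Finset E) (τ : E → ℕ),
    (∀ e ∈ F, τ e = 1 ∨ τ e = 2) → ResidualCon3 ends o a₁ a₂ a₃ b F →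
      0 ≤ typedCount F (fun _ => false) τ
        (K3 ends o a₁ a₂ a₃ b : Config E → Config E → Config E → R)

/-- **The crux of record from (TRI) on `ResidualCon2`** (unconditional: the root-bridge same-side
class is p3's theorem `RootBridge.typedCount_nonneg_of_hasRootBridgeSameSide'`). -/
theorem HCov_all_of_residualCon2_all (hc : ResidualCon2_all R) : HCov_all R := by
  refine HCov_all_of_residualCon_all R ?_
  intro V E _ _ _ _ ends o a₁ a₂ a₃ b F τ hτ hres
  by_cases hbr : RootBridge.HasRootBridgeSameSide' ends o a₁ a₂ b F
  · exact RootBridge.typedCount_nonneg_of_hasRootBridgeSameSide' ends o a₁ a₂ a₃ b F τ hτ hbr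
  · exact hc V E ends o a₁ a₂ a₃ b F τ hτ ⟨hres, hbr⟩

/-- **CONDITIONAL on `TB14`: the crux of record from (TRI) on `ResidualCon3`** — the `a₃`-inactive
residual instances are p5's conditional theorem
`A3InactiveTyped.typedCount_nonneg_of_a3_typedDeg_zero`, the root coincidences of `a₃` vanish
(`typedCount_eq_zero_of_not_rootsDistinct`). -/
theorem HCov_all_of_residualCon3_all (hTB : A3InactiveTyped.TB14 R) (hc : ResidualCon3_all R) :
    HCov_all R := by
  refine HCov_all_of_residualCon2_all R ?_
  intro V E _ _ _ _ ends o a₁ a₂ a₃ b F τ hτ hres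
  by_cases h3 : ∃ e ∈ F, a₃ ∈ ends e
  · exact hc V E ends o a₁ a₂ a₃ b F τ hτ ⟨hres, h3⟩
  · by_cases hd : RootsDistinct o a₁ a₂ a₃ b
    · exact A3InactiveTyped.typedCount_nonneg_of_a3_typedDeg_zero hTB ends o a₁ a₂ a₃ b F
        (fun e he h => h3 ⟨e, he, h⟩) hd.2.1.symm hd.2.2.1.symm τ hτ
    · rw [typedCount_eq_zero_of_not_rootsDistinct ends hd]

end Closure

end TypedRed

end CovForm

end Summit.Ventures.PercRepro2
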